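import Literature.Probability.RandomPlanarGeometry.HexSAWPolygonCellsRayClear
import HarnessLib

/-!
# Cell calculus for honeycomb polygon surgery, XIV: LEMMA P for the flip and the roof, packaged (ports ready for re-growing sticks)

Topic `Literature/Probability/RandomPlanarGeometry` (lane «pcv-sawmu», a-p4 g21; sequel of parts III (P1), VIII (P3), XI (P2)).

For the two Madras–Slade bases of the step-two injection «OMEGA» (`HOME/pub-sawmu-a-p4/g21/omega/THEOREM-OMEGA-g21.md` §2) this file states
LEMMA P as single theorems, in exactly the form consumed by the ray lemma `perim_union_ray` of part IV:
* `ReadyPort C p` — `p ∉ C`, `p` has one contact in `C`, `UL p ∉ C`, `R p ∉ C`, `RayClear C p`;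
* `readyPort_portX` — every host `d` of a brick set `S` of class X (`L t ∈ S`) has `ReadyPort (flipImage S t) (portX t d)`;
* `readyPort_portR` — every host `d` of a brick set `S` with `LR t ∈ S`… given the run `e_0..e_{k−1}`, `e_k ∉ S`, and `d` outside the run, has
  `ReadyPort (S ∪ roof t k) (portR t k d)`;
* `perim_union_ray_of_readyPort` — hence `perim (C ∪ ray p ℓ) = perim C + 4ℓ` for such ports (part IV);
together with the diagonal separations `portX_diag_gap`, `portR_diag_gap` of part VIII these are (P1)–(P3) for the bases EX and ER.

Sources: N. Madras, G. Slade, *The Self-Avoiding Walk* (1993), §3.2, proof of Theorem 3.2.3 [MadrasSlade1993]; I. Jensen, J. Phys.: Conf.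
Ser. 42 (2006) 163 [Jensen2006HoneycombPolygons].  Label (lane): LANE INFRASTRUCTURE; nothing new in writing.
-/

open Finset

namespace Literature.Probability.RandomPlanarGeometry.SAW

namespace HexCell

/-- A port ready for re-growing a stick: clean leaf spot, lower contact, ray-clear.
[cite: MadrasSlade1993, §3.2 (proof of Theorem 3.2.3: re-attaching the removed units at the image's top)] -/
structure ReadyPort (C : Finset Cell) (p : Cell) : Prop where
  notMem : p ∉ C
  one : #(nbrs p ∩ C) = 1
  ul : UL p ∉ C
  r : R p ∉ C
  clear : RayClear C p

/-- A ready port grows a stick of any length at `4` per hexagon (part IV). [cite: MadrasSlade1993, §3.2 (proof of Theorem 3.2.3)] -/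
theorem perim_union_ray_of_readyPort {C : Finset Cell} {p : Cell} (h : ReadyPort C p) (ℓ : ℕ) :
    perim (C ∪ ray p ℓ) = perim C + 4 * ℓ :=
  perim_union_ray h.notMem h.one h.ul h.r h.clear ℓ

/-- ★ **LEMMA P (P1),(P2) for the flip.** [cite: MadrasSlade1993, §3.2 (proof of Theorem 3.2.3)] -/
theorem readyPort_portX {S : Finset Cell} {t d : Cell} (hS : IsBrickSet S) (ht : IsLexmax S t) (hL : L t ∈ S) (hd : IsHost S d) :
    ReadyPort (insert (UL t) S) (portX t d) := by
  by_cases hdt : d = t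
  · subst hdt
    have hp : portX d d = UR (UL d) := by simp [portX]
    rw [hp]
    obtain ⟨hclear, hul, hr⟩ := rayClear_portX ht
    exact ⟨portX_notMem ht, card_contacts_portX ht, hul, hr, hclear⟩
  · have hp : portX t d = UR d := by simp [portX, hdt]
    rw [hp]
    obtain ⟨hnot, hone⟩ := card_contacts_ur_insert_ul_of_isHost hS ht hL hd hdt
    obtain ⟨hclear, hul, hr⟩ := rayClear_ur_insert_ul_of_isHost hS ht hL hd hdt
    exact ⟨hnot, hone, hul, hr, hclear⟩

/-- For a host `d ≠ t` outside the run, the default port `UR d` keeps exactly one contact in the roofed set.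
[cite: MadrasSlade1993, §3.2 (proof of Theorem 3.2.3)] -/
theorem card_contacts_ur_union_roof_of_isHost {S : Finset Cell} {t d : Cell} (hS : IsBrickSet S) (ht : IsLexmax S t) {k : ℕ}
    (hrun : ∀ i < k, runCell t i ∈ S) (hend : runCell t k ∉ S) (hd : IsHost S d) (hne : d ≠ t) (hdr : ∀ i < k, d ≠ runCell t i) :
    UR d ∉ S ∪ roof t k ∧ #(nbrs (UR d) ∩ (S ∪ roof t k)) = 1 := by
  classical
  obtain ⟨a, b⟩ := t
  obtain ⟨x, y⟩ := d
  have hloc : (y = b ∧ x ≤ a - 4) ∨ (y = b - 1 ∧ a + 2 * k + 3 ≤ x) := by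
    rcases hd.row_cases hS ht with ⟨hy, -, hx⟩ | ⟨hy, -⟩
    · rcases hx with hx | hx
      · exact absurd hx hne
      · exact Or.inl ⟨hy, hx⟩
    · right
      have := hd.lowRow_ge_of_run hS ht hrun hend hy hdr
      simp only at hy this ⊢; exact ⟨hy, this⟩
  -- no roof cell is a neighbour of `UR d`, and `UR d` is not a roof cell
  have hroof : ∀ c ∈ roof (a, b) k, c ∉ nbrs (UR (x, y)) ∧ c ≠ UR (x, y) := by
    intro c hc
    obtain ⟨i, hi, rfl⟩ := mem_roof.1 hc
    simp only [mem_nbrs_iff, UR_fst, UR_snd, Prod.ext_iff, roofCell_fst, roofCell_snd, not_or, ne_eq]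
    rcases hloc with ⟨hy, hx⟩ | ⟨hy, hx⟩ <;> omega
  refine ⟨?_, ?_⟩
  · rw [mem_union, not_or]
    exact ⟨hd.ur_notMem, fun hm => (hroof _ hm).2 rfl⟩
  · have : nbrs (UR (x, y)) ∩ (S ∪ roof (a, b) k) = nbrs (UR (x, y)) ∩ S := by
      ext c
      simp only [mem_inter, mem_union]
      constructor
      · rintro ⟨hc, hcS | hcR⟩
        · exact ⟨hc, hcS⟩
        · exact absurd hc (hroof _ hcR).1
      · rintro ⟨hc, hcS⟩; exact ⟨hc, Or.inl hcS⟩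
    rw [this, card_contacts_ur_of_isHost hd]

/-- ★ **LEMMA P (P1),(P2) for the roof** (hosts outside the run; `k ≥ 1`). [cite: MadrasSlade1993, §3.2 (proof of Theorem 3.2.3)] -/
theorem readyPort_portR {S : Finset Cell} {t d : Cell} (hS : IsBrickSet S) (ht : IsLexmax S t) {k : ℕ} (hk : 1 ≤ k)
    (hrun : ∀ i < k, runCell t i ∈ S) (hend : runCell t k ∉ S) (hd : IsHost S d) (hdr : ∀ i < k, d ≠ runCell t i) :
    ReadyPort (S ∪ roof t k) (portR t k d) := by
  by_cases hdt : d = t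
  · subst hdt
    have hp : portR d k d = UR (roofCell d (k - 1)) := by simp [portR]
    rw [hp]
    obtain ⟨hnot, hone⟩ := card_contacts_portR ht hk hend
    obtain ⟨hclear, hul, hr⟩ := rayClear_portR ht k
    exact ⟨hnot, hone, hul, hr, hclear⟩
  · have hp : portR t k d = UR d := by simp [portR, hdt]
    rw [hp]
    obtain ⟨hnot, hone⟩ := card_contacts_ur_union_roof_of_isHost hS ht hrun hend hd hdt hdr
    obtain ⟨hclear, hul, hr⟩ := rayClear_ur_union_roof_of_isHost hS ht hrun hend hd hdt hdr
    exact ⟨hnot, hone, hul, hr, hclear⟩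

end HexCell

end Literature.Probability.RandomPlanarGeometry.SAW
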